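import Literature.Claims.NS.Vukolov2026
import Literature.Barriers.NavierStokesRegularity.DiffeomorphismNonInvarianceGauge
import HarnessLib

/-!
# C170 `Vukolov2026` — SALVAGE (b) record: the barrier `DiffeomorphismNonInvariance` instantiated in
# the skeleton's own vocabulary — a `GaugeFamily` (Def 2.6 / §2.4 as typed) and a globally regular
# reference field whose gauge-conjugate `(ψ_t)_* V_ax(t)` is NOT a Navier–Stokes solution

Cell `ns-claims` (D-0090), lane ns-claims-salvage-p6 g4, records-grade ADDENDUM for #158 (head
`Literature.Claims.NS.Vukolov2026.Step_C23`, class false lemma, untouched). The skeleton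
`Literature/Claims/NS/Vukolov2026.lean` types Definition 2.6 p.12 l.22–27 as `InA ν V₀`: a `GaugeFamily`
(forward/inverse maps jointly `C^∞` on `[0,∞) × ℝ³`, mutually inverse for `t ≥ 0`, `ψ₀ = id`), a jointly
smooth reference field `V_ax` and a pressure such that `t ↦ pushforward (ψ t) (ψi t) (V_ax t)` is a
classical solution. This file records, by the tree's barrier (method cell T11 of the map):

* `pushforward_eq` — the skeleton's `Vukolov2026.pushforward` IS the barrier's `DiffeoGauge.pushforward`
  (definitionally);
* `switchedGauge : GaugeFamily` — the barrier's switched cubic shear gauge `x + λ(t)(x₁³/6)e₀`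
  (`λ = Real.smoothTransition`) packaged as a `GaugeFamily` of the skeleton (all five fields discharged
  by the barrier's lemmas);
* `exists_gaugeFamily_conjugate_not_solution` — for every `ν` there are a `GaugeFamily` and a jointly
  smooth reference field `V_ax` that is ITSELF a global classical solution (the uniform stream `e₁`, even
  with `V_ax 0 = V(0)` since `ψ₀ = id`) such that `t ↦ (ψ_t)_* V_ax(t)` is a classical solution for NO
  pressure: the clause «`V(t) = (ψ_t)_* V_ax(t)` satisfying the Navier–Stokes equations» inside Def 2.6
  is a constraint coupling the gauge to the field, not a consequence of `V_ax` solving anything — which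
  is why membership collapses to «a global solution exists» under the identity gauge
  (`Vukolov2026.inA_iff_globalSol`) and why the Euclidean axisymmetric theorem `Step_axisym` has no
  purchase on a gauge-manufactured `V_ax`.

WHAT THIS IS NOT: not a claim about NS regularity or blow-up; not a claim about any author beyond the
typed locator.
-/

set_option linter.dupNamespace false

noncomputable section

open Set Function

namespace Summit.NavierStokesRegularity.NavierStokesRegularity.Theorems.Vukolov2026Gauge

open Literature.Analysis.FluidPDE Literature.Claims.NS Literature.Claims.NS.Vukolov2026
open Literature.Barriers.NavierStokesRegularity.DiffeoGauge

/-- The skeleton's push-forward (§2.1 p.10 l.11–12, (6) p.11) is the barrier's `DiffeoGauge.pushforward`,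
definitionally. [cite: Vukolov2026, §2.1 p.10 l.11–12; (6) p.11 l.20–24] -/
theorem pushforward_eq (φ φi : E3 → E3) (W : E3 → E3) :
    Vukolov2026.pushforward φ φi W =
      Literature.Barriers.NavierStokesRegularity.DiffeoGauge.pushforward φ φi W := rfl

/-- **The switched cubic shear gauge as a `GaugeFamily` of the skeleton** (§2.4 p.11 l.14 «a smooth
one-parameter family of diffeomorphisms with ψ0 = id»): `ψ_t(x) = x + λ(t)(x₁³/6)e₀`,
`λ = Real.smoothTransition`. [cite: Vukolov2026, §2.4 (5)–(8) p.11 l.12–33; (19) p.15 l.42–55] -/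
private def switchedGauge : GaugeFamily where
  ψ := gauge
  ψi := gaugeInv
  smooth := (isSmoothSpaceTimeOn_gauge (Ici 0)).1
  smooth_inv := (isSmoothSpaceTimeOn_gauge (Ici 0)).2
  left_inv := fun t _ x => leftInverse_gauge t x
  right_inv := fun t _ y => rightInverse_gauge t y
  init := gauge_zero

/-- **Def 2.6's Navier–Stokes clause is a genuine constraint on the pair (gauge, reference field)**:
for every `ν` there are a `GaugeFamily` (the switched cubic shear gauge) and a jointly smooth reference
field `V_ax ≡ e₁` which is itself a GLOBAL classical solution with zero pressure, such that the
conjugate `t ↦ (ψ_t)_* V_ax(t)` — equal to `V_ax` at `t = 0` — is a classical solution on `[0, ∞)`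
for NO pressure (tree barrier `DiffeoGauge.not_isClassicalNSSolutionOn_gauge_stream`).
[cite: Vukolov2026, Def 2.6 p.12 l.22–27; (6) p.11 l.20–25; §10.2 Step 3 p.35 l.30–34] -/
theorem exists_gaugeFamily_conjugate_not_solution (ν : ℝ) :
    ∃ (G : GaugeFamily) (Vax : ℝ → E3 → E3),
      IsSmoothSpaceTimeOn (Ici 0) Vax ∧
      IsClassicalNSSolutionOn (Ici 0) ν 0 Vax (fun _ _ => (0 : ℝ)) ∧
      Vukolov2026.pushforward (G.ψ 0) (G.ψi 0) (Vax 0) = Vax 0 ∧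
      ∀ q : ℝ → E3 → ℝ,
        ¬ IsClassicalNSSolutionOn (Ici 0) ν 0 (fun t => Vukolov2026.pushforward (G.ψ t) (G.ψi t) (Vax t)) q := by
  refine ⟨switchedGauge, fun _ _ => (1 : ℝ) • EuclideanSpace.single (1 : Fin 3) (1 : ℝ),
    contDiff_const.contDiffOn, isClassicalNSSolutionOn_uniformStream (uniqueDiffOn_Ici 0) ν 1, ?_, ?_⟩
  · -- at `t = 0` the gauge is the identity
    funext y
    have h0 : switchedGauge.ψ 0 = id := funext gauge_zero
    have h0i : switchedGauge.ψi 0 = id := by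
      funext z
      have := leftInverse_gauge 0 z
      rw [show gauge 0 z = z from gauge_zero z] at this
      exact this
    simp [Vukolov2026.pushforward, h0, h0i, fderiv_id]
  · intro q
    exact not_isClassicalNSSolutionOn_gauge_stream one_ne_zero ν q

end Summit.NavierStokesRegularity.NavierStokesRegularity.Theorems.Vukolov2026Gauge

end
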